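import Summits.CriticalPhenomena.PercolationContinuityZ3.Theorems.PercNearOneGluingNoHeavyLowerTailKnQuestion8CoefficientwiseCoreClassKernelMixShortThreadsBase
import Summits.CriticalPhenomena.PercolationContinuityZ3.Theorems.PercNearOneGluingNoHeavyLowerTailKnQuestion8CoefficientwiseCoreClassKernelMixBundleThreeThreadIET
import Summits.CriticalPhenomena.PercolationContinuityZ3.Theorems.PercNearOneGluingNoHeavyLowerTailKnQuestion8CoefficientwiseCoreClassKernelMixBundleWithUnitThreadIET
import HarnessLib

/-!
# IET on bundles with at most three long threads — the base cases in finset-indexed form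

Support file (`--supports stmt-CriticalPhenomena-4575`, closed), prover `prim-cplus-coupling` (gen 70).  No definitions, no notations, no named facts,
no sorries; standard axioms.  Memo `prim-cplus-coupling/A5-COUPLING-gen70.md` §8 (COROLLARY C).

The induction of …LongThreadsMain (removal of threads of length 2 by THEOREM A = `iet_split_shortThread`, gen 53) runs over explicit bundles whose
threads are indexed by a FINSET `T ⊆ ℕ`.  This file supplies
* `finset_nat_enum` — an enumeration `τ : ℕ → ℕ` of a finset `T ⊆ ℕ` by `0, …, |T| − 1` (injective on that range, onto `T`);
* `iet_fin_withUnitThread` — finset-indexed bundle data with a thread `t₀ ∈ T` of length 1 (any number of threads of any lengths): IET for every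
  up-closed event and all monotone real levels, by re-indexing and `iet_bundle_withUnitThread` (gen 67);
* `iet_fin_threeThreads` — finset-indexed bundle data with `|T| = 3`: IET by re-indexing and `iet_bundle_threeThreads` (gen 59).
[cite: KozmaNitzan2024, Questions 8–9 (§5.5 p. 36) (context); Harris 1960]
-/

namespace Summit.CriticalPhenomena.PercolationContinuityZ3.Theorems

open Finset Literature.Probability.Percolation

namespace Coefficientwise

variable {ι V : Type*}

/-- **Enumeration of a finite set of naturals.**  For `T : Finset ℕ` there is `τ : ℕ → ℕ` mapping `{0, …, |T|−1}` injectively onto `T`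
(the increasing enumeration `Finset.orderEmbOfFin`, extended by `0`). [folklore] -/
theorem finset_nat_enum (T : Finset ℕ) :
    ∃ τ : ℕ → ℕ, (∀ t, t < T.card → τ t ∈ T) ∧ (∀ t t', t < T.card → t' < T.card → t ≠ t' → τ t ≠ τ t') ∧
      (∀ s ∈ T, ∃ t, t < T.card ∧ τ t = s) := by
  refine ⟨fun t => if ht : t < T.card then T.orderEmbOfFin rfl ⟨t, ht⟩ else 0, ?_, ?_, ?_⟩
  · intro t ht
    simp only [dif_pos ht]
    exact T.orderEmbOfFin_mem rfl ⟨t, ht⟩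
  · intro t t' ht ht' hne heq
    simp only [dif_pos ht, dif_pos ht'] at heq
    have := (T.orderEmbOfFin rfl).injective heq
    rw [Fin.mk.injEq] at this
    exact hne this
  · intro s hs
    have hs' : s ∈ Set.range (T.orderEmbOfFin rfl) := by
      rw [Finset.range_orderEmbOfFin]; exact Finset.mem_coe.mpr hs
    obtain ⟨i, hi⟩ := hs'
    exact ⟨i.val, i.isLt, by simp only [dif_pos i.isLt]; exact hi⟩

open Classical in
/-- **Base case: a unit thread (finset-indexed form).**  Finset-indexed explicit bundle data (as in `iet_base_twoThreads`) with a thread `t₀ ∈ T`,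
`L t₀ = 1`: the IET sum is nonnegative for every up-closed event and all monotone real levels `0 ≤ hᵃ, hᵇ ≤ h`, `0 ≤ kᵃ, kᵇ ≤ k` —
`iet_bundle_withUnitThread` after enumerating `T`. [cite: KozmaNitzan2024, Questions 8–9 (§5.5 p. 36) (context); Harris 1960] -/
theorem iet_fin_withUnitThread (ends : ι → Sym2 V) (T : Finset ℕ) (L : ℕ → ℕ) (hL : ∀ t ∈ T, 1 ≤ L t)
    (w : ℕ → ℕ → V) (e : ℕ → ℕ → ι) (u b : V)
    (hw0 : ∀ t ∈ T, w t 0 = u) (hwL : ∀ t ∈ T, w t (L t) = b)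
    (harc : ∀ t ∈ T, ∀ j, 1 ≤ j → j ≤ L t → ends (e t j) = s(w t (j - 1), w t j))
    (hwinj : ∀ t ∈ T, ∀ i j, i ≤ L t → j ≤ L t → w t i = w t j → i = j)
    (hcross : ∀ t ∈ T, ∀ t' ∈ T, t ≠ t' → ∀ i j, i ≤ L t → j ≤ L t' → w t i = w t' j → (i = 0 ∧ j = 0) ∨ (i = L t ∧ j = L t'))
    (A : ℕ → Finset ι) (hA : ∀ t ∈ T, ∀ i, i ∈ A t ↔ ∃ j, 1 ≤ j ∧ j ≤ L t ∧ e t j = i)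
    (hAdisj : ∀ t ∈ T, ∀ t' ∈ T, t ≠ t' → Disjoint (A t) (A t'))
    (E : Finset ι) (hEA : ∀ i, i ∈ E ↔ ∃ t ∈ T, i ∈ A t)
    (t₀ : ℕ) (ht₀ : t₀ ∈ T) (hL1 : L t₀ = 1)
    (𝒱 : Finset ι → Prop) (hV : ∀ ⦃s t : Finset ι⦄, s ⊆ t → 𝒱 s → 𝒱 t)
    (h k ha hb ka kb : Set V → ℝ) (mh : Monotone h) (mk : Monotone k)
    (mha : Monotone ha) (mhb : Monotone hb) (mka : Monotone ka) (mkb : Monotone kb)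
    (ha0 : ∀ S, 0 ≤ ha S) (hah : ∀ S, ha S ≤ h S) (hb0 : ∀ S, 0 ≤ hb S) (hbh : ∀ S, hb S ≤ h S)
    (ka0 : ∀ S, 0 ≤ ka S) (kak : ∀ S, ka S ≤ k S) (kb0 : ∀ S, 0 ≤ kb S) (kbk : ∀ S, kb S ≤ k S) :
    0 ≤ (∑ ω ∈ E.powerset, if 𝒱 ω ∧ b ∈ openCluster (ends '' (↑ω : Set ι)) u ∧ b ∉ openCluster (ends '' (↑(E \ ω) : Set ι)) u then
        h (openCluster (ends '' (↑ω : Set ι)) u) * k (openCluster (ends '' (↑ω : Set ι)) u) else 0)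
      + ∑ ω ∈ E.powerset, if 𝒱 ω ∧ b ∈ openCluster (ends '' (↑(E \ ω) : Set ι)) u ∧ b ∉ openCluster (ends '' (↑ω : Set ι)) u then
        (ha (openCluster (ends '' (↑ω : Set ι)) u) - hb (openCluster (ends '' (↑(E \ ω) : Set ι)) u)) *
          (ka (openCluster (ends '' (↑ω : Set ι)) u) - kb (openCluster (ends '' (↑(E \ ω) : Set ι)) u)) else 0 := by
  obtain ⟨τ, τmem, τinj, τsurj⟩ := finset_nat_enum T
  have hEA' : ∀ i, i ∈ E ↔ ∃ t, t < T.card ∧ i ∈ A (τ t) := by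
    intro i
    rw [hEA i]
    constructor
    · rintro ⟨s, hs, hi⟩
      obtain ⟨t, ht, rfl⟩ := τsurj s hs
      exact ⟨t, ht, hi⟩
    · rintro ⟨t, ht, hi⟩
      exact ⟨τ t, τmem t ht, hi⟩
  obtain ⟨tc, htc, hτtc⟩ := τsurj t₀ ht₀
  have hunit : L (τ tc) = 1 := by rw [hτtc]; exact hL1
  exact iet_bundle_withUnitThread ends T.card (fun t => L (τ t)) (fun t ht => hL _ (τmem t ht))
    (fun t => w (τ t)) (fun t => e (τ t)) u b (fun t ht => hw0 _ (τmem t ht)) (fun t ht => hwL _ (τmem t ht))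
    (fun t ht => harc _ (τmem t ht)) (fun t ht => hwinj _ (τmem t ht))
    (fun t t' ht ht' hne => hcross _ (τmem t ht) _ (τmem t' ht') (τinj t t' ht ht' hne))
    (fun t => A (τ t)) (fun t ht => hA _ (τmem t ht)) (fun t t' ht ht' hne => hAdisj _ (τmem t ht) _ (τmem t' ht') (τinj t t' ht ht' hne))
    E hEA' tc htc hunit 𝒱 hV h k ha hb ka kb mh mk mha mhb mka mkb ha0 hah hb0 hbh ka0 kak kb0 kbk

open Classical in
/-- **Base case: exactly three threads (finset-indexed form).**  Finset-indexed explicit bundle data with `|T| = 3` (threads of arbitrary lengths):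
the IET sum is nonnegative for every up-closed event and all monotone real levels — `iet_bundle_threeThreads` after enumerating `T`.
[cite: KozmaNitzan2024, Questions 8–9 (§5.5 p. 36) (context); Harris 1960] -/
theorem iet_fin_threeThreads (ends : ι → Sym2 V) (T : Finset ℕ) (L : ℕ → ℕ) (hL : ∀ t ∈ T, 1 ≤ L t)
    (w : ℕ → ℕ → V) (e : ℕ → ℕ → ι) (u b : V)
    (hw0 : ∀ t ∈ T, w t 0 = u) (hwL : ∀ t ∈ T, w t (L t) = b)
    (harc : ∀ t ∈ T, ∀ j, 1 ≤ j → j ≤ L t → ends (e t j) = s(w t (j - 1), w t j))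
    (hwinj : ∀ t ∈ T, ∀ i j, i ≤ L t → j ≤ L t → w t i = w t j → i = j)
    (hcross : ∀ t ∈ T, ∀ t' ∈ T, t ≠ t' → ∀ i j, i ≤ L t → j ≤ L t' → w t i = w t' j → (i = 0 ∧ j = 0) ∨ (i = L t ∧ j = L t'))
    (A : ℕ → Finset ι) (hA : ∀ t ∈ T, ∀ i, i ∈ A t ↔ ∃ j, 1 ≤ j ∧ j ≤ L t ∧ e t j = i)
    (hAdisj : ∀ t ∈ T, ∀ t' ∈ T, t ≠ t' → Disjoint (A t) (A t'))
    (E : Finset ι) (hEA : ∀ i, i ∈ E ↔ ∃ t ∈ T, i ∈ A t) (hT3 : T.card = 3)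
    (𝒱 : Finset ι → Prop) (hV : ∀ ⦃s t : Finset ι⦄, s ⊆ t → 𝒱 s → 𝒱 t)
    (h k ha hb ka kb : Set V → ℝ) (mh : Monotone h) (mk : Monotone k)
    (mha : Monotone ha) (mhb : Monotone hb) (mka : Monotone ka) (mkb : Monotone kb)
    (ha0 : ∀ S, 0 ≤ ha S) (hah : ∀ S, ha S ≤ h S) (hb0 : ∀ S, 0 ≤ hb S) (hbh : ∀ S, hb S ≤ h S)
    (ka0 : ∀ S, 0 ≤ ka S) (kak : ∀ S, ka S ≤ k S) (kb0 : ∀ S, 0 ≤ kb S) (kbk : ∀ S, kb S ≤ k S) :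
    0 ≤ (∑ ω ∈ E.powerset, if 𝒱 ω ∧ b ∈ openCluster (ends '' (↑ω : Set ι)) u ∧ b ∉ openCluster (ends '' (↑(E \ ω) : Set ι)) u then
        h (openCluster (ends '' (↑ω : Set ι)) u) * k (openCluster (ends '' (↑ω : Set ι)) u) else 0)
      + ∑ ω ∈ E.powerset, if 𝒱 ω ∧ b ∈ openCluster (ends '' (↑(E \ ω) : Set ι)) u ∧ b ∉ openCluster (ends '' (↑ω : Set ι)) u then
        (ha (openCluster (ends '' (↑ω : Set ι)) u) - hb (openCluster (ends '' (↑(E \ ω) : Set ι)) u)) *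
          (ka (openCluster (ends '' (↑ω : Set ι)) u) - kb (openCluster (ends '' (↑(E \ ω) : Set ι)) u)) else 0 := by
  obtain ⟨τ, τmem, τinj, τsurj⟩ := finset_nat_enum T
  rw [hT3] at τmem τinj τsurj
  have hEA' : ∀ i, i ∈ E ↔ ∃ t, t < 3 ∧ i ∈ A (τ t) := by
    intro i
    rw [hEA i]
    constructor
    · rintro ⟨s, hs, hi⟩
      obtain ⟨t, ht, rfl⟩ := τsurj s hs
      exact ⟨t, ht, hi⟩
    · rintro ⟨t, ht, hi⟩
      exact ⟨τ t, τmem t ht, hi⟩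
  exact iet_bundle_threeThreads ends 3 (fun t => L (τ t)) (fun t ht => hL _ (τmem t ht))
    (fun t => w (τ t)) (fun t => e (τ t)) u b (fun t ht => hw0 _ (τmem t ht)) (fun t ht => hwL _ (τmem t ht))
    (fun t ht => harc _ (τmem t ht)) (fun t ht => hwinj _ (τmem t ht))
    (fun t t' ht ht' hne => hcross _ (τmem t ht) _ (τmem t' ht') (τinj t t' ht ht' hne))
    (fun t => A (τ t)) (fun t ht => hA _ (τmem t ht)) (fun t t' ht ht' hne => hAdisj _ (τmem t ht) _ (τmem t' ht') (τinj t t' ht ht' hne))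
    E hEA' 0 1 2 (by omega) (by omega) (by omega) (by omega) (by omega) (by omega) (fun t ht => by omega)
    𝒱 hV h k ha hb ka kb mh mk mha mhb mka mkb ha0 hah hb0 hbh ka0 kak kb0 kbk

end Coefficientwise

end Summit.CriticalPhenomena.PercolationContinuityZ3.Theorems
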